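import Literature.Computability.QuantumComplexity.QAOAIsomorphism
import Mathlib.LinearAlgebra.Matrix.Kronecker
import HarnessLib

/-!
# QAOA edge terms live on a sub-register of size independent of `n` (Farhi–Goldstone–Gutmann 2014, §2)

Topic `Literature/Computability/QuantumComplexity` (pub-qadeq lane); companion to
`QAOALevelOneMaxCut.lean`, whose `lightCone` / `edgeExpectP_eq_touching` show that the term
`⟨γ,β|C_{⟨jk⟩}|γ,β⟩` of `F_p` is unchanged when `G` is replaced by its restriction `touching G T` to
the edges meeting a set `T ⊇` (qubits within distance `p − 1` of `{j, k}`) — but still as an operator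
on the FULL register `V → Bool`. FGG §2 says more: the term “depends only on the subgraph involving
qubits `j` and `k` and those at a distance no more than `p` away”, so that `F_p` is given “in terms of
quantum subsystems whose sizes are independent of `n`” (for bounded degree). This file proves that
statement in the register sense: for any `S ⊇ N(T)` the term equals the SAME expression computed for
the graph restricted to the vertex set `S`, on the `|S|`-qubit register `S → Bool`
(`edgeExpectP_eq_restrict`). The tool is the embedding `O ↦ O ⊗ 1` of sub-register operators
(`embed`, a Kronecker product re-indexed along `(V → Bool) ≃ (S → Bool) × (Sᶜ → Bool)`), under which
the cost layer of a graph with all edges inside `S`, the mixer, the initial state and the edge terms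
factor, and traces against `ρ₀` are preserved.

HONEST FRAMING: instance-level adjudication of specific advantage claims; no claim about BQP vs
BPP or the summit. This is the structural fact behind “fixed `p`, bounded degree ⇒ each term of
`F_p` is a finite computation independent of `n`”; no complexity claim is formalised here.

## Source (held text, read at the cited places)

* [FarhiGoldstoneGutmann2014] E. Farhi, J. Goldstone, S. Gutmann, arXiv:1411.4028, §2 (tex chunk p0004):
  “the operator associated with edge ⟨jk⟩, `U†…U† C_⟨jk⟩ U…U`, only involves qubits j and k and those
  qubits whose distance on the graph from j or k is less than or equal to p”; “each term in equation
  (13) depends only on the subgraph involving qubits j and k and those at a distance no more than p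
  away”; “F_p(γ,β) = Σ_g w_g f_g(γ,β) (24) where … f_g does not depend on n and m. … the function F_p
  is given in terms of quantum subsystems whose sizes are independent of n”.

## What is formalised

* `split S : (V → Bool) ≃ (S → Bool) × ({i // i ∉ S} → Bool)` and **`embed S O N = (O ⊗ₖ N)`
  re-indexed** to the full register (private plumbing: entries, multiplicativity, `1`, `†`, trace,
  and the factorisation of every tensor-product operator), hence `initialState_eq_embed`,
  `mixUnitary_eq_embed`; **`trace_embed_mul_initialState`** (`tr[(O ⊗ 1) ρ₀^V] = tr[O ρ₀^S]`).
* `restrictGraph S H` (the graph `H` on the vertex set `S`) and, for `H` with all edges inside `S`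
  (hypothesis `∀ a b, H.Adj a b → a ∈ S`), **`costUnitary_eq_embed`** (for `H` with all edges inside `S`, `U_V(C_H, γ) = U_S(C_{H|S}, γ) ⊗ 1`),
  `edgeTerm_eq_embed`.
* **`conj_embed`**: `U_p(H)† (O ⊗ 1) U_p(H) = (U_p(H|S)† O U_p(H|S)) ⊗ 1` for such `H`, at every level
  `p` and all angles; **`edgeExpectP_restrictGraph`**: the level-`p` edge expectation of `H` on the
  register `V` equals that of `H|S` on the register `S`.
* **`edgeExpectP_eq_restrict`** (FGG §2 as stated): for any graph `G`, edge `⟨ab⟩`, `T` containing the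
  balls of radius `< p` about `{a, b}` and `S ⊇ N(T)`,
  `⟨γ,β|C_⟨ab⟩|γ,β⟩_G = ⟨γ,β|C_⟨ab⟩|γ,β⟩_{(touching G T)|S}` — the right side is a computation on `|S|`
  qubits, `|S|` bounded in terms of `p` and the maximum degree only.
* (v2) **`edgeExpectP_eq_restrict_ball`**: the canonical instance `T =` ball of radius `p − 1`,
  `S =` ball of radius `p` about `{a, b}` (`p ≥ 1`): the term is computed on the register of “qubits j
  and k and those qubits whose distance on the graph from j or k is less than or equal to p”.
* (v3, with `QAOAIsomorphism.lean`) **`edgeExpectP_eq_of_rooted_iso`**: FGG (24) — if the radius-`p`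
  edge neighbourhoods of `⟨a₁b₁⟩ ∈ G₁` and `⟨a₂b₂⟩ ∈ G₂` are isomorphic as rooted graphs, the level-`p`
  terms agree: `f_g` is a function of the subgraph type `g` only.
* NOT formalised: the counting of subgraph types `w_g` in (24)–(25) and any running-time statement
  (isomorphism invariance across registers is `QAOAIsomorphism.lean`, used in v3).

0 named facts, 0 sorry.
-/

noncomputable section

open Matrix Finset
open scoped Kronecker

namespace Literature.Computability.QuantumComplexity

namespace QAOA

variable {V : Type*} [Fintype V] [DecidableEq V] (S : Finset V)

/-! ### The sub-register embedding `O ↦ O ⊗ 1` -/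

/-- Splitting a bit string into its parts on `S` and off `S`. [folklore] -/
def split : (V → Bool) ≃ ((S → Bool) × ({i // i ∉ S} → Bool)) :=
  Equiv.piEquivPiSubtypeProd (· ∈ S) fun _ => Bool

/-- The operator `O ⊗ N` on the full register, for `O` on the qubits in `S` and `N` on the others
(FGG's “quantum subsystems”: `O ⊗ 1` is the operator `O` “involving only” the qubits of `S`). [cite:
FarhiGoldstoneGutmann2014, §2 (“operator … only involves qubits j and k and those qubits whose distance
… is less than or equal to p”)] -/
def embed (O : Matrix (S → Bool) (S → Bool) ℂ) (N : Matrix ({i // i ∉ S} → Bool) ({i // i ∉ S} → Bool) ℂ) :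
    Matrix (V → Bool) (V → Bool) ℂ :=
  (O ⊗ₖ N).submatrix (split S) (split S)

omit [Fintype V] in
/-- Entries of the embedding. [folklore] -/
private theorem embed_apply (O : Matrix (S → Bool) (S → Bool) ℂ)
    (N : Matrix ({i // i ∉ S} → Bool) ({i // i ∉ S} → Bool) ℂ) (x y : V → Bool) :
    embed S O N x y = O (fun i => x i) (fun i => y i) * N (fun i => x i) (fun i => y i) := rfl

/-- `(O ⊗ N)(O′ ⊗ N′) = OO′ ⊗ NN′`. [folklore] -/
private theorem embed_mul (O O' : Matrix (S → Bool) (S → Bool) ℂ)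
    (N N' : Matrix ({i // i ∉ S} → Bool) ({i // i ∉ S} → Bool) ℂ) :
    embed S (O * O') (N * N') = embed S O N * embed S O' N' := by
  rw [embed, embed, embed, submatrix_mul_equiv, mul_kronecker_mul]

/-- `1 ⊗ 1 = 1`. [folklore] -/
private theorem embed_one : embed S (1 : Matrix (S → Bool) (S → Bool) ℂ) 1 = 1 := by
  rw [embed, one_kronecker_one, submatrix_one_equiv]

omit [Fintype V] in
/-- `(O ⊗ N)† = O† ⊗ N†`. [folklore] -/
private theorem embed_conjTranspose (O : Matrix (S → Bool) (S → Bool) ℂ)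
    (N : Matrix ({i // i ∉ S} → Bool) ({i // i ∉ S} → Bool) ℂ) :
    (embed S O N)ᴴ = embed S Oᴴ Nᴴ := by
  rw [embed, embed, conjTranspose_submatrix, conjTranspose_kronecker]

/-- `tr(O ⊗ N) = tr O · tr N`. [folklore] -/
private theorem trace_embed (O : Matrix (S → Bool) (S → Bool) ℂ)
    (N : Matrix ({i // i ∉ S} → Bool) ({i // i ∉ S} → Bool) ℂ) :
    (embed S O N).trace = O.trace * N.trace := by
  rw [← trace_kronecker, embed, Matrix.trace, Matrix.trace]
  simp only [diag_apply, submatrix_apply]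
  exact Equiv.sum_comp (split S) (fun z => (O ⊗ₖ N) z z)

omit [DecidableEq V] in
/-- Every tensor-product operator factors along `S`: `⊗_{i∈V} g_i = (⊗_{i∈S} g_i) ⊗ (⊗_{i∉S} g_i)`
(plumbing behind the factorisations of `ρ₀` and `U(B, β)` below). [folklore] -/
private theorem tensorAll_eq_embed [DecidableEq V] (g : V → Matrix Bool Bool ℂ) :
    tensorAll g = embed S (tensorAll fun i : S => g i) (tensorAll fun i : {i // i ∉ S} => g i) := by
  ext x y
  rw [embed_apply, tensorAll_apply, tensorAll_apply, tensorAll_apply,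
    Finset.prod_coe_sort S (fun i => g i (x i) (y i)),
    ← Finset.prod_subtype Sᶜ (by simp) (fun i => g i (x i) (y i)), Finset.prod_mul_prod_compl]

/-- `ρ₀^V = ρ₀^S ⊗ ρ₀^{V∖S}`. [cite: FarhiGoldstoneGutmann2014, eq. (5) (|s⟩ = |+⟩^{⊗n})] -/
theorem initialState_eq_embed :
    (initialState : Matrix (V → Bool) (V → Bool) ℂ) = embed S initialState initialState :=
  tensorAll_eq_embed S _

/-- `U_V(B, β) = U_S(B, β) ⊗ U_{V∖S}(B, β)`. [cite: FarhiGoldstoneGutmann2014, eq. (4) (U(B,β) =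
∏_j e^{−iβσ^x_j})] -/
theorem mixUnitary_eq_embed (β : ℝ) :
    (mixUnitary β : Matrix (V → Bool) (V → Bool) ℂ) = embed S (mixUnitary β) (mixUnitary β) :=
  tensorAll_eq_embed S _

/-- **`tr[(O ⊗ 1) ρ₀^V] = tr[O ρ₀^S]`:** expectations of sub-register operators in the product state
are computed on the sub-register. [cite: FarhiGoldstoneGutmann2014, §2 (“quantum subsystems whose sizes
are independent of n”)] -/
theorem trace_embed_mul_initialState (O : Matrix (S → Bool) (S → Bool) ℂ) :
    (embed S O 1 * initialState).trace = (O * initialState).trace := by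
  rw [initialState_eq_embed S, ← embed_mul, trace_embed, Matrix.one_mul, trace_initialState, mul_one]

/-- A diagonal operator on `S`, embedded, is diagonal. [folklore] -/
private theorem embed_diagonal_one (d : (S → Bool) → ℂ) :
    embed S (diagonal d) 1 = diagonal fun x : V → Bool => d fun i => x i := by
  ext x y
  rw [embed_apply, diagonal_apply, diagonal_apply, one_apply]
  by_cases hxy : x = y
  · subst hxy
    simp
  · rw [if_neg hxy]
    by_cases h1 : (fun i : S => x i) = (fun i : S => y i)
    · have h2 : (fun i : {i // i ∉ S} => x i) ≠ (fun i : {i // i ∉ S} => y i) := by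
        intro h2
        apply hxy
        funext i
        by_cases hi : i ∈ S
        · exact congr_fun h1 ⟨i, hi⟩
        · exact congr_fun h2 ⟨i, hi⟩
      rw [if_neg h2, mul_zero]
    · rw [if_neg h1, zero_mul]

/-! ### Graphs with all edges inside `S` -/

variable (H : SimpleGraph V) [DecidableRel H.Adj]

/-- The graph `H` restricted to the vertex set `S` (on the vertex TYPE `S`). [cite:
FarhiGoldstoneGutmann2014, §2 (“the subgraph involving qubits j and k and those at a distance no more
than p away”)] -/
def restrictGraph : SimpleGraph S := H.comap (Function.Embedding.subtype (· ∈ S))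

/-- Adjacency in the restricted graph is decidable. [folklore] -/
instance restrictGraphDecidableRel : DecidableRel (restrictGraph S H).Adj := fun a b =>
  inferInstanceAs (Decidable (H.Adj a.1 b.1))

omit [Fintype V] [DecidableEq V] [DecidableRel H.Adj] in
/-- “All edges of `H` lie inside `S`” is the hypothesis `∀ a b, H.Adj a b → a ∈ S`; then both endpoints
of an edge are in `S`. [folklore] -/
private theorem mem₂_of_edgesIn {S : Finset V} {H : SimpleGraph V} (h : ∀ a b, H.Adj a b → a ∈ S)
    {a b : V} (hab : H.Adj a b) : a ∈ S ∧ b ∈ S :=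
  ⟨h a b hab, h b a hab.symm⟩

omit [DecidableEq V] in
/-- The cut value is computed on `S`. [folklore] -/
private theorem cutValue_restrictGraph (h : ∀ a b, H.Adj a b → a ∈ S) (x : V → Bool) :
    cutValue (restrictGraph S H) (fun i : S => x i) = cutValue H x := by
  unfold cutValue
  refine Finset.sum_bij (fun e _ => e.map Subtype.val) ?_ ?_ ?_ ?_
  · intro e he
    induction e using Sym2.ind with
    | h u v =>
      rw [SimpleGraph.mem_edgeFinset, SimpleGraph.mem_edgeSet] at he
      rw [Sym2.map_mk, SimpleGraph.mem_edgeFinset, SimpleGraph.mem_edgeSet]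
      exact he
  · intro e _ e' _ hee'
    exact Sym2.map.injective Subtype.val_injective hee'
  · intro e' he'
    induction e' using Sym2.ind with
    | h a b =>
      rw [SimpleGraph.mem_edgeFinset, SimpleGraph.mem_edgeSet] at he'
      obtain ⟨ha, hb⟩ := mem₂_of_edgesIn h he'
      refine ⟨s(⟨a, ha⟩, ⟨b, hb⟩), ?_, by rw [Sym2.map_mk]⟩
      rw [SimpleGraph.mem_edgeFinset, SimpleGraph.mem_edgeSet]
      exact he'
  · intro e _
    induction e using Sym2.ind with
    | h u v => rw [Sym2.map_mk, cutInd_mk, cutInd_mk]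

/-- **The phase separator of a graph with all edges inside `S` factors: `U_V(C_H, γ) = U_S(C_{H|S}, γ)
⊗ 1`.** [cite: FarhiGoldstoneGutmann2014, §2 (“Any factors in the operator U(C, γ) which do not
involve [these] qubits … commute through and cancel out”)] -/
theorem costUnitary_eq_embed (h : ∀ a b, H.Adj a b → a ∈ S) (γ : ℝ) :
    costUnitary H γ = embed S (costUnitary (restrictGraph S H) γ) 1 := by
  rw [costUnitary, costUnitary, embed_diagonal_one]
  congr 1
  funext x
  rw [cutValue_restrictGraph S H h]

/-- **An edge term inside `S` factors: `C_⟨ab⟩ = C_⟨ab⟩^S ⊗ 1`.** [cite: FarhiGoldstoneGutmann2014,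
eq. (12)] -/
theorem edgeTerm_eq_embed {a b : V} (ha : a ∈ S) (hb : b ∈ S) :
    (edgeTerm s(a, b) : Matrix (V → Bool) (V → Bool) ℂ) =
      embed S (edgeTerm s((⟨a, ha⟩ : S), (⟨b, hb⟩ : S))) 1 := by
  rw [edgeTerm_eq_diagonal, edgeTerm_eq_diagonal, embed_diagonal_one]
  congr 1

/-- Regrouping a conjugation by a three-fold product. [folklore] -/
private theorem conj_mul_three {n : Type*} [Fintype n] (A B C X : Matrix n n ℂ) :
    (A * B * C)ᴴ * X * (A * B * C) = Cᴴ * (Bᴴ * (Aᴴ * X * A) * B) * C := by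
  simp only [conjTranspose_mul, Matrix.mul_assoc]

/-- **Conjugating a sub-register operator by the level-`p` circuit of a graph with all edges inside
`S` stays on the sub-register:** `U_p(H)† (O ⊗ 1) U_p(H) = (U_p(H|S)† O U_p(H|S)) ⊗ 1` (the mixer
factors off `S` cancel by unitarity, the cost layer is already `· ⊗ 1`). [cite:
FarhiGoldstoneGutmann2014, §2 (“The factors in the operator U(B, β) which do not involve qubits j or
k commute through … and we get … Any factors in the operator U(C, γ) which do not involve [these]
qubits will commute through and cancel out … This operator only involves qubits …”)] -/
theorem conj_embed (h : ∀ a b, H.Adj a b → a ∈ S) (p : ℕ) :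
    ∀ (γ β : Fin p → ℝ) (O : Matrix (S → Bool) (S → Bool) ℂ),
      (qaoaUnitaryP H p γ β)ᴴ * embed S O 1 * qaoaUnitaryP H p γ β =
        embed S ((qaoaUnitaryP (restrictGraph S H) p γ β)ᴴ * O * qaoaUnitaryP (restrictGraph S H) p γ β) 1 := by
  induction p with
  | zero =>
    intro γ β O
    simp only [qaoaUnitaryP, conjTranspose_one, Matrix.one_mul, Matrix.mul_one]
  | succ p ih =>
    intro γ β O
    rw [qaoaUnitaryP, qaoaUnitaryP, conj_mul_three, conj_mul_three]
    have hmix : (mixUnitary (β (Fin.last p)) : Matrix (V → Bool) (V → Bool) ℂ)ᴴ * embed S O 1 *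
        mixUnitary (β (Fin.last p)) =
        embed S ((mixUnitary (β (Fin.last p)))ᴴ * O * mixUnitary (β (Fin.last p))) 1 := by
      rw [mixUnitary_eq_embed S, embed_conjTranspose, ← embed_mul, ← embed_mul, Matrix.mul_one,
        mixUnitary_conjTranspose_mul_mixUnitary]
    have hcost : ∀ Y : Matrix (S → Bool) (S → Bool) ℂ,
        (costUnitary H (γ (Fin.last p)))ᴴ * embed S Y 1 * costUnitary H (γ (Fin.last p)) =
        embed S ((costUnitary (restrictGraph S H) (γ (Fin.last p)))ᴴ * Y *
          costUnitary (restrictGraph S H) (γ (Fin.last p))) 1 := by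
      intro Y
      rw [costUnitary_eq_embed S H h, embed_conjTranspose, ← embed_mul, ← embed_mul, conjTranspose_one,
        Matrix.one_mul, Matrix.one_mul]
    rw [hmix, hcost, ih]

/-- `tr[O · UρU†] = tr[U†OU · ρ]` (cyclicity), on any register. [folklore] -/
private theorem trace_mul_finalStateP' {W : Type*} [Fintype W] [DecidableEq W] (K : SimpleGraph W)
    [DecidableRel K.Adj] (p : ℕ) (γ β : Fin p → ℝ) (O : Matrix (W → Bool) (W → Bool) ℂ) :
    (O * finalStateP K p γ β).trace = ((qaoaUnitaryP K p γ β)ᴴ * O * qaoaUnitaryP K p γ β * initialState).trace := by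
  rw [finalStateP, ← Matrix.mul_assoc, ← Matrix.mul_assoc, Matrix.trace_mul_comm, ← Matrix.mul_assoc,
    ← Matrix.mul_assoc]

/-- **The level-`p` edge expectation of a graph with all edges inside `S` is computed on the register
`S`:** `⟨γ,β|C_⟨ab⟩|γ,β⟩_H = ⟨γ,β|C_⟨ab⟩|γ,β⟩_{H|S}`. [cite: FarhiGoldstoneGutmann2014, §2 (“each term
… depends only on the subgraph involving qubits j and k and those at a distance no more than p away”)] -/
theorem edgeExpectP_restrictGraph (h : ∀ a b, H.Adj a b → a ∈ S) (p : ℕ) (γ β : Fin p → ℝ) {a b : V} (ha : a ∈ S)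
    (hb : b ∈ S) :
    edgeExpectP H p γ β s(a, b) =
      edgeExpectP (restrictGraph S H) p γ β s((⟨a, ha⟩ : S), (⟨b, hb⟩ : S)) := by
  rw [edgeExpectP, edgeExpectP, trace_mul_finalStateP', trace_mul_finalStateP', edgeTerm_eq_embed S ha hb,
    conj_embed S H h, trace_embed_mul_initialState]

/-! ### FGG §2: each term of `F_p` is a computation on a sub-register of size independent of `n` -/

variable (G : SimpleGraph V) [DecidableRel G.Adj]

/-- The edges meeting `T` lie inside `N(T)`. [folklore] -/
private theorem edgesIn_touching {T S' : Finset V} (hS : nbhd G T ⊆ S') :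
    ∀ a b, (touching G T).Adj a b → a ∈ S' := by
  intro a b hab
  apply hS
  simp only [nbhd, Finset.mem_union, Finset.mem_biUnion, SimpleGraph.mem_neighborFinset]
  rcases hab with ⟨hadj, ha | hb⟩
  · exact Or.inl ha
  · exact Or.inr ⟨b, hb, hadj.symm⟩

/-- **FGG §2, register form.** For any graph `G`, edge `⟨ab⟩`, any `T` containing the qubits within
distance `p − 1` of `{a, b}` and any `S ⊇ N(T)` (e.g. the qubits within distance `p`), the level-`p` term
`⟨γ,β|C_⟨ab⟩|γ,β⟩` of `F_p` equals the same quantity computed for the graph `(touching G T)|S` on the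
`|S|`-qubit register — “quantum subsystems whose sizes are independent of n”. [cite:
FarhiGoldstoneGutmann2014, §2 (paragraph after eq. (16)) and eq. (24) (“f_g does not depend on n and
m”)] -/
theorem edgeExpectP_eq_restrict (p : ℕ) (γ β : Fin p → ℝ) {a b : V} {T : Finset V}
    (hT : ∀ k, k < p → ball G k {a, b} ⊆ T) (hS : nbhd G T ⊆ S) (ha : a ∈ S) (hb : b ∈ S) :
    edgeExpectP G p γ β s(a, b) =
      edgeExpectP (restrictGraph S (touching G T)) p γ β s((⟨a, ha⟩ : S), (⟨b, hb⟩ : S)) := by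
  rw [edgeExpectP_eq_touching G p γ β hT]
  exact edgeExpectP_restrictGraph S (touching G T) (edgesIn_touching G hS) p γ β ha hb


/-! ### The canonical choice `S =` the qubits within distance `p` of the edge -/

/-- `ball (k+1) S = N(ball k S)`. [folklore] -/
private theorem ball_succ_eq (k : ℕ) (S' : Finset V) : ball G (k + 1) S' = nbhd G (ball G k S') := by
  rw [ball, ball, Function.iterate_succ_apply']

/-- Balls grow with the radius. [folklore] -/
private theorem ball_mono' {k q : ℕ} (hkq : k ≤ q) (S' : Finset V) : ball G k S' ⊆ ball G q S' := by
  induction q, hkq using Nat.le_induction with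
  | base => exact subset_refl _
  | succ q _ ih =>
    rw [ball_succ_eq]
    exact ih.trans Finset.subset_union_left

/-- The endpoints lie in every ball about the edge. [folklore] -/
private theorem mem_ball_pair (q : ℕ) (a b : V) : a ∈ ball G q {a, b} ∧ b ∈ ball G q {a, b} :=
  ⟨ball_mono' G (Nat.zero_le q) {a, b} (by simp [ball]), ball_mono' G (Nat.zero_le q) {a, b} (by simp [ball])⟩

/-- **FGG §2 with the canonical subsystem: the term `⟨γ,β|C_⟨ab⟩|γ,β⟩` of `F_p` (`p ≥ 1`) is the same
quantity computed on the register of the qubits within distance `p` of `{a, b}`, for the graph of the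
edges within `p` steps of `⟨ab⟩`** (“this operator only involves qubits j and k and those qubits whose
distance on the graph from j or k is less than or equal to p … only involves edges at most p steps away
from ⟨jk⟩ and qubits on those edges”). [cite: FarhiGoldstoneGutmann2014, §2 (paragraph around eqs.
(14)–(16))] -/
theorem edgeExpectP_eq_restrict_ball {p : ℕ} (hp : 0 < p) (γ β : Fin p → ℝ) (a b : V) :
    edgeExpectP G p γ β s(a, b) =
      edgeExpectP (restrictGraph (ball G p {a, b}) (touching G (ball G (p - 1) {a, b}))) p γ β
        s((⟨a, (mem_ball_pair G p a b).1⟩ : ↥(ball G p {a, b})), (⟨b, (mem_ball_pair G p a b).2⟩ : ↥(ball G p {a, b}))) := by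
  refine edgeExpectP_eq_restrict (ball G p {a, b}) G p γ β (fun k hk => ball_mono' G (by omega) _) ?_ _ _
  obtain ⟨q, rfl⟩ := Nat.exists_eq_add_of_le hp
  rw [Nat.add_sub_cancel_left, Nat.add_comm, ball_succ_eq]


/-! ### FGG (24): the term is a function of the rooted subgraph TYPE only -/

/-- **`f_g` depends only on the subgraph type (FGG eq. (24)).** If the radius-`p` edge neighbourhoods
of `⟨a₁b₁⟩` in `G₁` and of `⟨a₂b₂⟩` in `G₂` (graphs on unrelated registers `V₁`, `V₂`) are isomorphic
as rooted graphs — an isomorphism of the restricted graphs sending `a₁ ↦ a₂`, `b₁ ↦ b₂` — then the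
level-`p` terms agree: `⟨γ,β|C_⟨a₁b₁⟩|γ,β⟩_{G₁} = ⟨γ,β|C_⟨a₂b₂⟩|γ,β⟩_{G₂}` for all angles (“F_p(γ,β) =
Σ_g w_g f_g(γ,β) where the sum is over all subgraph types … f_g does not depend on n and m”). [cite:
FarhiGoldstoneGutmann2014, §3 eq. (24) and §2] -/
theorem edgeExpectP_eq_of_rooted_iso {V₂ : Type*} [Fintype V₂] [DecidableEq V₂] (G₂ : SimpleGraph V₂)
    [DecidableRel G₂.Adj] {p : ℕ} (hp : 0 < p) (γ β : Fin p → ℝ) (a₁ b₁ : V) (a₂ b₂ : V₂)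
    (ψ : restrictGraph (ball G p {a₁, b₁}) (touching G (ball G (p - 1) {a₁, b₁})) ≃g
      restrictGraph (ball G₂ p {a₂, b₂}) (touching G₂ (ball G₂ (p - 1) {a₂, b₂})))
    (ha : ψ ⟨a₁, (mem_ball_pair G p a₁ b₁).1⟩ = ⟨a₂, (mem_ball_pair G₂ p a₂ b₂).1⟩)
    (hb : ψ ⟨b₁, (mem_ball_pair G p a₁ b₁).2⟩ = ⟨b₂, (mem_ball_pair G₂ p a₂ b₂).2⟩) :
    edgeExpectP G p γ β s(a₁, b₁) = edgeExpectP G₂ p γ β s(a₂, b₂) := by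
  rw [edgeExpectP_eq_restrict_ball G hp, edgeExpectP_eq_restrict_ball G₂ hp, ← ha, ← hb,
    edgeExpectP_iso _ _ ψ]

end QAOA

end Literature.Computability.QuantumComplexity
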